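import Summits.Schanuel.Schanuel.Theorems.DiophantineDichotomyApproximationPropertyLowSurfaceOr
import Summits.Schanuel.Schanuel.Theorems.DiophantineDichotomyApproximationPropertySmallLowSurfaceOrLemmas
import HarnessLib

/-!
# Stub `pointDatum_or_smallLowSurface3_of` of line `orbit-interpolation-determinant` (crux `ApproximationProperty`, stmt-Schanuel-6117) — datum, or the satellite lies on a SMALL low-degree prime surface

Route `DiophantineDichotomy` (sub-problem `Schanuel/Schanuel`), crux
`Summit.Schanuel.Schanuel.Theses.DiophantineDichotomy.ApproximationProperty` (stmt-Schanuel-6117), line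
`orbit-interpolation-determinant`, skeleton v27 (lead `prover-line-stmt-Schanuel-6117-c13-0`), registered stub
`pointDatum_or_smallLowSurface3_of`: the landed low-surface dichotomy `pointDatum_or_lowSurface3`
(…LowSurfaceOr.lean) with its second branch STRENGTHENED by smallness splitting. Given the factorisation
statement of the sibling stub `primePartSplit3` (taken as the antecedent), for a datum of the clause-free descent at
`(Δ, 8Y)` whose orbit `𝔭` lies on a rank-2 prime `𝔮' ≤ 𝔭` enveloping it at level `⌊C₄Δ⌋`: EITHER a
`PointAPAbsAt 3`-datum at `(Δ, Y)`, OR a non-zero form `F` of degree `1 ≤ d ≤ Δ/M₁`, `h(F) ≤ 8Y/c₁`, with a prime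
factor `Q₂ ∈ 𝔮'` of degree `1 ≤ a₂ ≤ d` which is moreover SMALL at `ω̄ = (1 : ω)`:
`h(Q₂) ≤ 8Y/c₁ + 4Δ/M₁` and `‖Q₂‖_ω̄ ≤ exp(−a₂ (Δ/M₁)² 8Y/(3200 c₁))`.

Proof: Dirichlet's box principle (landed `boxPrinciple`) at degree `d = ⌊Δ/M₁⌋`, height `Y/c₁`, gives a small form
`F`, `log(1/|F(ω̄)|) ≥ R + 4d`, `R = ((binom(d+3,3) − 4)/2) log(N+1) − c_B(d+1) − 4d`. A small form `G ∉ 𝔮'` of degree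
`≤ d`, height `≤ 2Y/c₁` and `|G(ω̄)| ≤ e^{−R/2}|G|` gives the datum (`G ∉ 𝔭` by the landed envelope transport,
Nesterenko's PROVED Prop. 4.11 with `r = 1`, the landed packaging `pointDatum_of_closeZero`; bookkeeping: the rate of
…LowSurfaceOr halved, its `M₀` doubled). If `F ∉ 𝔮'`, take `G = F`. If `F ∈ 𝔮'`, split `F = G₂ · ∏ᵢ pᵢ` (antecedent:
`G₂ ∉ 𝔮'`, primes `pᵢ ∈ 𝔮'` of degrees `aᵢ ≥ 1`, `∑ aᵢ ≤ d`, heights `≤ h(F) + 4d`, `|F| ≤ e^{4d}|G₂|∏|pᵢ|`), so that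
`(|G₂(ω̄)|/|G₂|) · ∏ᵢ (|pᵢ(ω̄)|/|pᵢ|) ≤ e^{−R}`: either `|G₂(ω̄)| ≤ e^{−R/2}|G₂|` (then `deg G₂ ≥ 1`, take `G = G₂`),
or `∏ᵢ |pᵢ(ω̄)|/|pᵢ| ≤ e^{−R/2}` and, by a weighted pigeonhole (`∑ aᵢ ε ≤ R/2` for `ε = (Δ/M₁)² 8Y/(3200c₁)` once
`Δ` is large), some `pᵢ` has `‖pᵢ‖_ω̄ ≤ |pᵢ(ω̄)|/|pᵢ| ≤ e^{−aᵢ ε}`. The real-arithmetic bookkeeping is in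
`…SmallLowSurfaceOrLemmas.lean` (`liouville_exponent_lt'`, `smallLowSurface_half_rate_le`, `rateB_le`, `prod_part_le`,
`exists_le_exp_mul`, `exp_neg_le_of_one_le`).

Proofs only: no definitions, no named facts beyond the DISCHARGED Prop. 4.11 / Prop. 4.4. Sources: Nesterenko,
LNM 1752 (2001) Ch. 3 §4 Prop. 4.11 (pp. 40–41); Nesterenko–Philippon (eds.), LNM 1752 Ch. 4 §4 p. 61 (AP2).
-/

set_option linter.dupNamespace false

noncomputable section

namespace Summit.Schanuel.Schanuel.Cruxes.ApproximationProperty.OrbitInterpolationDeterminant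

open Literature.NumberTheory.Transcendental Literature.NumberTheory.Transcendental.Nesterenko
  Literature.NumberTheory.Transcendental.PhilipponMain MvPolynomial Real
open scoped BigOperators Nat

open HighSatellite SmallLowSurface in
/-- **Registered stub `pointDatum_or_smallLowSurface3_of`** (crux `stmt-Schanuel-6117`, line
`orbit-interpolation-determinant`, skeleton v27): GIVEN the prime-part splitting of forms in a prime ideal of
`ℚ[x₀, …, x₃]` (the statement of the sibling stub `primePartSplit3`, as antecedent), for every `ω ∈ ℂ³`, `c₁ ≥ 1`,
`C₄ ≥ c₁` and `M₁ ≥ 64c₁` there are `λ = 8` and `c ≥ c₁` such that at every scale `Y ≥ Δ ≥ c`, a datum of the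
clause-free descent at `(Δ, λY)` whose orbit lies on a rank-2 prime `𝔮' ≤ 𝔭` enveloping it at level `⌊C₄Δ⌋` yields
EITHER a `PointAPAbsAt 3`-datum at `(Δ, Y)` OR a non-zero form `F` of degree `1 ≤ d ≤ Δ/M₁`, `h(F) ≤ λY/c₁`, with a
prime factor `Q₂ ∈ 𝔮'` of degree `1 ≤ a₂ ≤ d`, `h(Q₂) ≤ λY/c₁ + 4Δ/M₁`, `‖Q₂‖_ω̄ ≤ exp(−a₂ (Δ/M₁)² λY/(3200 c₁))`
(module docstring). [cite: NesterenkoPhilippon2001, Ch. 3 Prop. 4.11 (pp. 40–41); Ch. 4 §4 (p. 61)] -/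
theorem pointDatum_or_smallLowSurface3_of : (∀ (F : Rx 3) (d : ℕ) (𝔮' : Ideal (Rx 3)), F ≠ 0 → F.IsHomogeneous d → 𝔮'.IsPrime → F ∈ 𝔮' → ∃ (G₂ : Rx 3) (d₂ k : ℕ) (p : Fin k → Rx 3) (a : Fin k → ℕ), G₂ ≠ 0 ∧ G₂ ∉ 𝔮' ∧ G₂.IsHomogeneous d₂ ∧ (∀ i, p i ≠ 0 ∧ p i ∈ 𝔮' ∧ (p i).IsHomogeneous (a i) ∧ 1 ≤ a i ∧ (Ideal.span {p i}).IsPrime) ∧ 1 ≤ k ∧ F = G₂ * ∏ i, p i ∧ d = d₂ + ∑ i, a i ∧ height G₂ ≤ height F + 4 * d ∧ (∀ i, height (p i) ≤ height F + 4 * d) ∧ maxNorm F ≤ Real.exp (4 * d) * maxNorm G₂ * ∏ i, maxNorm (p i)) → ∀ (ω : Fin 3 → ℂ) (c₁ : ℝ), 1 ≤ c₁ → ∀ C₄ : ℝ, c₁ ≤ C₄ → ∀ M₁ : ℝ, 64 * c₁ ≤ M₁ → ∃ lam : ℝ, 1 ≤ lam ∧ ∃ c : ℝ, c₁ ≤ c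 ∧ ∀ Δ Y : ℝ, c ≤ Δ → Δ ≤ Y → ∀ (Q : Rx 3) (a : ℕ) (P : Rx 3) (b : ℕ) (𝔮 : Ideal (Rx 3)) (T : Rx 3) (τ : ℕ) (𝔭 𝔮' : Ideal (Rx 3)), CycleAP3Datum ω c₁ Δ (lam * Y) Q a P b 𝔮 T τ 𝔭 → 𝔮'.IsPrime → IsUnmixedOfRank 𝔮' 2 → 𝔮' ≤ 𝔭 → homogeneousSubmodule (Fin (3 + 1)) ℚ ⌊C₄ * Δ⌋₊ ⊓ 𝔭.restrictScalars ℚ ≤ 𝔮'.restrictScalars ℚ → (∃ (K : Type) (_ : Field K) (_ : NumberField K) (β : Fin 3 → K) (σ : K →+* ℂ), (Module.finrank ℚ K : ℝ) ≤ (c * Δ) ^ 3 ∧ Height.logHeight (Fin.cons (1 : K) β : Fin (3 + 1) → K) ≤ c * Y * Δ ^ 2 ∧ ‖(fun j => σ (β j)) - ω‖ ≤ Real.exp (-((Δ * Height.logHeight (Fin.cons (1 : K) β : Fin (3 + 1) → K) + Y * Module.finrank ℚ K) / c))) ∨ (∃ (F Q₂ : Rx 3) (d a₂ : ℕ), F ≠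 0 ∧ F.IsHomogeneous d ∧ 1 ≤ d ∧ (d : ℝ) ≤ Δ / M₁ ∧ height F ≤ lam * Y / c₁ ∧ Q₂ ≠ 0 ∧ Q₂.IsHomogeneous a₂ ∧ 1 ≤ a₂ ∧ a₂ ≤ d ∧ (Ideal.span {Q₂}).IsPrime ∧ Q₂ ∣ F ∧ Q₂ ∈ 𝔮' ∧ height Q₂ ≤ lam * Y / c₁ + 4 * Δ / M₁ ∧ normAt (Fin.cons 1 ω) Q₂ ≤ Real.exp (-((a₂ : ℝ) * (Δ / M₁) ^ 2 * (lam * Y) / (3200 * c₁)))) := by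
  intro hsplit ω c₁ hc₁ C₄ hC₄ M₁ hM₁
  classical
  have hc₁0 : 0 < c₁ := by linarith
  have hM₁0 : 0 < M₁ := by linarith
  -- constants at `ω`
  obtain ⟨cB, hcB, hbox₁⟩ := boxPrinciple 3 ω
  obtain ⟨κ, hκdef⟩ : ∃ κ : ℝ, κ = 1 / M₁ := ⟨_, rfl⟩
  have hκ0 : 0 < κ := hκdef ▸ by positivity
  have hκ64 : κ ≤ 1 / (64 * c₁) := by rw [hκdef]; exact one_div_le_one_div_of_le (by positivity) hM₁
  have hκ1 : κ ≤ 1 := hκ64.trans (by rw [div_le_one (by positivity)]; linarith)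
  obtain ⟨r₀, hr₀def⟩ : ∃ r₀ : ℝ, r₀ = κ ^ 3 / 96 := ⟨_, rfl⟩
  have hr₀0 : 0 < r₀ := hr₀def ▸ by positivity
  -- the halved rate `r₁ = r₀/2` and the enlarged box constant `c_B + 1`
  obtain ⟨r₁, hr₁def⟩ : ∃ r₁ : ℝ, r₁ = r₀ / 2 := ⟨_, rfl⟩
  have hr₁0 : 0 < r₁ := hr₁def ▸ by positivity
  have hcB1 : 0 < cB + 1 := by linarith
  obtain ⟨M₀, hM₀def⟩ : ∃ M₀ : ℝ, M₀ = 2 * c₁ * (8 * c₁ + c₁ ^ 3) / r₁ := ⟨_, rfl⟩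
  have hM₀ : 0 < M₀ := hM₀def ▸ by positivity
  -- the packaging constant (boost `λ = 8`)
  obtain ⟨cP, hcP, hpack⟩ :=
    pointDatum_of_closeZero 3 (by norm_num) stub_zeroDimDictionary ω c₁ 8 M₀ hc₁ (by norm_num) hM₀
  obtain ⟨c, hcdef⟩ : ∃ c : ℝ,
      c = cP + ((8 + 6 * c₁ * (cB + 1)) / r₁ + 1) + 10 / κ + 800 * c₁ * (cB + 2) / κ ^ 2 := ⟨_, rfl⟩
  have hpos1 : 0 ≤ (8 + 6 * c₁ * (cB + 1)) / r₁ + 1 := by positivity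
  have hpos2 : 0 ≤ 10 / κ := by positivity
  have hpos3 : 0 ≤ 800 * c₁ * (cB + 2) / κ ^ 2 := by positivity
  have hcPc : cP ≤ c := by rw [hcdef]; linarith
  have hcP0 : 0 < cP := by linarith
  refine ⟨8, by norm_num, c, hcP.trans hcPc, ?_⟩
  intro Δ Y hΔ hY Q a P b 𝔮 T τ 𝔭 𝔮' hdat h𝔮'p h𝔮'u hle henv
  -- unpack the datum
  obtain ⟨-, -, -, -, -, -, -, -, -, -, -, -, -, -, -, -, -, -, -, -, -,
    h𝔭p, h𝔭h, h𝔭u, -, -, -, hD, hh, habs⟩ := hdat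
  -- scales
  have hcPΔ : cP ≤ Δ := hcPc.trans hΔ
  have hΔ₁ : (8 + 6 * c₁ * (cB + 1)) / r₁ + 1 ≤ Δ := by rw [hcdef] at hΔ; linarith
  have hthr : 800 * c₁ * (cB + 2) / κ ^ 2 ≤ Δ := by rw [hcdef] at hΔ; linarith
  have hκΔ10 : 10 ≤ κ * Δ := by
    have h2 : 10 / κ ≤ Δ := by rw [hcdef] at hΔ; linarith
    rw [div_le_iff₀ hκ0] at h2
    linarith [mul_comm Δ κ]
  have hc₁Δ : c₁ ≤ Δ := hcP.trans hcPΔ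
  have hΔ1 : 1 ≤ Δ := hc₁.trans hc₁Δ
  have hΔ0 : 0 < Δ := by linarith
  have hY0 : 0 < Y := by linarith
  have hD1 : (1 : ℝ) ≤ ideg 𝔭 1 := by
    exact_mod_cast Literature.Barriers.Schanuel.one_le_ideg_of_isPrime
      NesterenkoPhilippon2001_ch3_prop_4_4_holds le_rfl (by norm_num) h𝔭p h𝔭h h𝔭u
  have hh0 : 0 ≤ iheight 𝔭 1 := height_nonneg _
  -- the auxiliary degree `d₁ = ⌊κΔ⌋ = ⌊Δ/M₁⌋`
  obtain ⟨d₁, hd₁def⟩ : ∃ d₁ : ℕ, d₁ = ⌊κ * Δ⌋₊ := ⟨_, rfl⟩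
  have hd₁le : (d₁ : ℝ) ≤ κ * Δ := hd₁def ▸ Nat.floor_le (by positivity)
  have hd₁ge : κ * Δ / 2 ≤ d₁ := by
    have := Nat.lt_floor_add_one (κ * Δ)
    rw [← hd₁def] at this
    linarith
  have hd₁pos : 1 ≤ d₁ := by
    have : (1 : ℝ) ≤ d₁ := by linarith
    exact_mod_cast this
  have hd₁pos' : (0 : ℝ) < d₁ := by exact_mod_cast hd₁pos
  have hd₁M : (d₁ : ℝ) ≤ Δ / M₁ := by rw [hκdef] at hd₁le; simpa [one_div, div_eq_inv_mul] using hd₁le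
  have h2d₁ : 2 * (d₁ : ℝ) ≤ Δ / (32 * c₁) := by
    calc 2 * (d₁ : ℝ) ≤ 2 * (κ * Δ) := by linarith
      _ ≤ 2 * (1 / (64 * c₁) * Δ) := by gcongr
      _ = Δ / (32 * c₁) := by field_simp; ring
  have h2d₁' : 2 * (d₁ : ℝ) ≤ Δ := h2d₁.trans (div_le_self hΔ0.le (by linarith))
  have h4d₁ : 4 * (d₁ : ℝ) ≤ Y / c₁ := by
    have e : 2 * (Δ / (32 * c₁)) ≤ Y / c₁ := by
      rw [show 2 * (Δ / (32 * c₁)) = Δ / 16 / c₁ by ring, div_le_div_iff_of_pos_right hc₁0]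
      linarith
    linarith
  -- the height scale `N = ⌊e^{Y/c₁}⌋`
  obtain ⟨N, hNdef⟩ : ∃ N : ℕ, N = ⌊Real.exp (Y / c₁)⌋₊ := ⟨_, rfl⟩
  have hN1 : 1 ≤ N := hNdef ▸ Nat.le_floor (by exact_mod_cast Real.one_le_exp (by positivity : 0 ≤ Y / c₁))
  have hNpos : (0 : ℝ) < N := by exact_mod_cast hN1
  have hlogN : Real.log N ≤ Y / c₁ := by
    calc Real.log N ≤ Real.log (Real.exp (Y / c₁)) :=
          Real.log_le_log hNpos (hNdef ▸ Nat.floor_le (Real.exp_pos _).le)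
      _ = Y / c₁ := Real.log_exp _
  have hlogN1 : Y / c₁ ≤ Real.log ((N : ℝ) + 1) := by
    rw [Real.le_log_iff_exp_le (by positivity)]
    exact (hNdef ▸ Nat.lt_floor_add_one (Real.exp (Y / c₁))).le
  have hL0 : 0 ≤ Real.log ((N : ℝ) + 1) := Real.log_nonneg (by linarith)
  -- a variable outside the satellite; the auxiliary degree sits below the envelope level
  obtain ⟨i, hi⟩ : ∃ i, (X i : Rx 3) ∉ 𝔮' := by
    haveI := h𝔮'p
    refine Literature.RingTheory.MvPolynomial.exists_X_notMem_of_ringKrullDim_ne_zero ?_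
    rw [SatelliteRestartGlue.rank_eq_two h𝔮'p h𝔮'u]
    exact_mod_cast (by norm_num : (2 : ℕ) ≠ 0)
  have hlev : d₁ ≤ ⌊C₄ * Δ⌋₊ := by
    refine Nat.le_floor ?_
    have : (d₁ : ℝ) ≤ Δ := by linarith
    exact this.trans (le_mul_of_one_le_left hΔ0.le (hc₁.trans hC₄))
  -- Step 1: Dirichlet in degree `d₁`
  have h4 : 4 ≤ (d₁ + 3).choose d₁ := by
    rw [Nat.choose_symm_add]
    calc 4 = (1 + 3).choose 3 := by decide
      _ ≤ (d₁ + 3).choose 3 := Nat.choose_le_choose 3 (by omega)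
  obtain ⟨F, hF0, hFhom, hF1, -, hFh, hFsmall⟩ := hbox₁ d₁ N ((d₁ + 3).choose d₁) hN1 h4 le_rfl
  have hFh' : height F ≤ Y / c₁ := hFh.trans hlogN
  have hFh8 : height F ≤ 8 * Y / c₁ := by
    refine hFh'.trans ?_
    rw [div_le_div_iff_of_pos_right hc₁0]
    linarith
  -- the rate `R = ((C−4)/2) L − c_B(d₁+1) − 4d₁`: `|F(ω̄)| ≤ e^{−R−4d₁}`
  have hC : ((d₁ : ℝ) + 1) ^ 3 ≤ 6 * (((d₁ + 3).choose d₁ : ℕ) : ℝ) := by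
    have h' : (d₁ + 1) ^ 3 ≤ 3 ! * (d₁ + 3).choose d₁ :=
      SmallPrimeHypersurface.succ_pow_le_factorial_mul_choose d₁ 3
    have h'' : (d₁ + 1) ^ 3 ≤ 6 * (d₁ + 3).choose d₁ := by simpa [Nat.factorial] using h'
    exact_mod_cast h''
  have hrate : r₀ * Δ ^ 3 - 2 ≤ ((((d₁ + 3).choose d₁ : ℕ) : ℝ) - 4) / 2 :=
    rateA hC hd₁ge hκ0.le hΔ0.le (le_of_eq hr₀def)
  obtain ⟨R, hRdef⟩ : ∃ R : ℝ, R = ((((d₁ + 3).choose d₁ : ℕ) : ℝ) - 4) / 2 * Real.log ((N : ℝ) + 1) -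
      cB * (d₁ + 1) - 4 * d₁ := ⟨_, rfl⟩
  -- the orbit's budgets, and the halved smallness bookkeeping
  have hX : Δ * iheight 𝔭 1 + Y * ideg 𝔭 1 ≤ (8 * c₁ + c₁ ^ 3) * Y * Δ ^ 3 := by
    have e1 : Δ * iheight 𝔭 1 ≤ Δ * (c₁ * (8 * Y) * Δ ^ 2) := mul_le_mul_of_nonneg_left hh hΔ0.le
    have e2 : Y * ideg 𝔭 1 ≤ Y * (c₁ * Δ) ^ 3 := mul_le_mul_of_nonneg_left hD hY0.le
    have e3 : Δ * (c₁ * (8 * Y) * Δ ^ 2) + Y * (c₁ * Δ) ^ 3 = (8 * c₁ + c₁ ^ 3) * Y * Δ ^ 3 := by ring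
    linarith
  have hX0 : 0 < Δ * iheight 𝔭 1 + Y * ideg 𝔭 1 := by
    have e1 : Y ≤ Y * ideg 𝔭 1 := le_mul_of_one_le_right hY0.le hD1
    have e2 : 0 ≤ Δ * iheight 𝔭 1 := mul_nonneg hΔ0.le hh0
    linarith
  have hRhalf : -(R / 2) ≤ -((Δ * iheight 𝔭 1 + Y * ideg 𝔭 1) / (2 * M₀)) := by
    have h1 := smallLowSurface_half_rate_le (cB := cB) (κ := κ) (L := Real.log ((N : ℝ) + 1)) hrate hL0 hcB.le
      hd₁pos'.le hd₁le
    have h2 := smallness_le (κ := κ) (L := Real.log ((N : ℝ) + 1)) hr₁0 hcB1 hκ1 hc₁ hΔ₁ hY hlogN1 hX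
    rw [← hM₀def] at h2
    rw [hr₁def] at h2
    rw [hRdef]
    linarith
  have hXM : 0 < (Δ * iheight 𝔭 1 + Y * ideg 𝔭 1) / (2 * M₀) := by positivity
  have hR0 : 0 ≤ R := by linarith
  have hexp_half : Real.exp (-(R / 2)) < 1 := Real.exp_lt_one_iff.mpr (by linarith)
  have hω₁0 : (Fin.cons 1 ω : Fin (3 + 1) → ℂ) ≠ 0 := fun h0 => by
    have := congr_fun h0 0
    simp at this
  have hω₁1 : 1 ≤ ‖(Fin.cons 1 ω : Fin (3 + 1) → ℂ)‖ := one_le_norm_cons_one ω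
  -- CASE A engine: a form OFF the satellite carrying half of the smallness gives the datum
  have caseA : ∀ (G : Rx 3) (dG : ℕ), G ≠ 0 → G ∉ 𝔮' → G.IsHomogeneous dG → 1 ≤ dG → dG ≤ d₁ →
      height G ≤ 2 * Y / c₁ →
      ‖aeval (Fin.cons 1 ω : Fin (3 + 1) → ℂ) G‖ ≤ Real.exp (-(R / 2)) * maxNorm G →
      ∃ (K : Type) (_ : Field K) (_ : NumberField K) (β : Fin 3 → K) (σ : K →+* ℂ),
        (Module.finrank ℚ K : ℝ) ≤ (c * Δ) ^ 3 ∧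
        Height.logHeight (Fin.cons (1 : K) β : Fin (3 + 1) → K) ≤ c * Y * Δ ^ 2 ∧
        ‖(fun j => σ (β j)) - ω‖ ≤ Real.exp (-((Δ * Height.logHeight (Fin.cons (1 : K) β : Fin (3 + 1) → K) +
          Y * Module.finrank ℚ K) / c)) := by
    intro G dG hG0 hG𝔮' hGhom hdG1 hdGle hGh hGsmall
    -- `G ∉ 𝔭` by the envelope
    have hG𝔭 : G ∉ 𝔭 := fun hmem => hG𝔮' (mem_of_envelope h𝔮'p hi henv hGhom (hdGle.trans hlev) hmem)
    -- Nesterenko's Prop. 4.11 with `r = 1`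
    have h411 := (NesterenkoPhilippon2001_ch3_prop_4_11_holds 3 1 𝔭 G dG le_rfl (by norm_num) h𝔭p h𝔭h h𝔭u
      hGhom hdG1 hG𝔭).2 rfl (Fin.cons 1 ω) hω₁0
    obtain ⟨E, hEdef⟩ : ∃ E : ℝ,
        E = height G * ideg 𝔭 1 + iheight 𝔭 1 * dG + 11 * ((3 : ℕ) : ℝ) ^ 2 * ideg 𝔭 1 * dG := ⟨_, rfl⟩
    rw [← hEdef] at h411
    have hdgΔ : (dG : ℝ) ≤ Δ / (32 * c₁) := by
      have : (dG : ℝ) ≤ d₁ := by exact_mod_cast hdGle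
      linarith
    have hElt : -((Δ * iheight 𝔭 1 + 8 * Y * ideg 𝔭 1) / c₁) + E < 0 := by
      rw [hEdef]
      push_cast
      exact liouville_exponent_lt' hc₁ hΔ0 hY hD1 hh0 hdgΔ hGh
    have hsmall𝔭 : iabs 𝔭 1 (Fin.cons 1 ω) * Real.exp E < 1 := by
      calc iabs 𝔭 1 (Fin.cons 1 ω) * Real.exp E
          ≤ Real.exp (-((Δ * iheight 𝔭 1 + 8 * Y * ideg 𝔭 1) / c₁)) * Real.exp E :=
            mul_le_mul_of_nonneg_right habs (Real.exp_pos _).le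
        _ = Real.exp (-((Δ * iheight 𝔭 1 + 8 * Y * ideg 𝔭 1) / c₁) + E) := by rw [← Real.exp_add]
        _ < 1 := Real.exp_lt_one_iff.mpr hElt
    have hρlt : rho (Fin.cons 1 ω) 𝔭 < normAt (Fin.cons 1 ω) G := by
      by_contra hcon
      rw [bezoutDelta_of_le (not_lt.mp hcon)] at h411
      exact lt_irrefl _ (lt_of_le_of_lt h411 hsmall𝔭)
    -- the form is that small
    have hnorm : normAt (Fin.cons 1 ω) G ≤ Real.exp (-((Δ * iheight 𝔭 1 + Y * ideg 𝔭 1) / (2 * M₀))) := by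
      have hMG : 0 < maxNorm G := maxNorm_pos hG0
      have h1 : normAt (Fin.cons 1 ω) G ≤ ‖aeval (Fin.cons 1 ω : Fin (3 + 1) → ℂ) G‖ / maxNorm G := by
        unfold normAt
        exact div_le_div_of_nonneg_left (norm_nonneg _) hMG
          (le_mul_of_one_le_right hMG.le (one_le_pow₀ hω₁1))
      have h2 : ‖aeval (Fin.cons 1 ω : Fin (3 + 1) → ℂ) G‖ / maxNorm G ≤ Real.exp (-(R / 2)) :=
        (div_le_iff₀ hMG).mpr hGsmall
      exact h1.trans (h2.trans (Real.exp_le_exp.mpr hRhalf))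
    -- some conjugate is within that distance
    have hne : (projDist (Fin.cons 1 ω : Fin (3 + 1) → ℂ) '' projZeros 𝔭).Nonempty := by
      obtain ⟨cd, -, hdict⟩ := stub_zeroDimDictionary 3 (by norm_num)
      obtain ⟨K, _i1, _i2, bK, hb0, hzeros, -⟩ := hdict 𝔭 h𝔭p h𝔭h h𝔭u
      obtain ⟨σ₀⟩ := (inferInstance : Nonempty (K →+* ℂ))
      have hz0 : (fun j => σ₀ (bK j)) ≠ 0 := by
        intro h0
        apply hb0
        funext j
        have := congr_fun h0 j
        simpa using this
      have hz : (fun j => σ₀ (bK j)) ∈ projZeros 𝔭 := (hzeros _).mpr ⟨hz0, σ₀, 1, by simp⟩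
      exact ⟨_, _, hz, rfl⟩
    obtain ⟨_, ⟨z, hz, rfl⟩, hzlt⟩ := exists_lt_of_csInf_lt hne hρlt
    have hzle : projDist (Fin.cons 1 ω) z ≤ Real.exp (-((Δ * iheight 𝔭 1 + Y * ideg 𝔭 1) / (2 * M₀))) :=
      (hzlt.trans_le hnorm).le
    -- packaging
    have hh' : iheight 𝔭 1 ≤ c₁ * (8 * Y) * Δ ^ (3 - 1) := by rw [show (3 : ℕ) - 1 = 2 from rfl]; exact hh
    obtain ⟨K, iF, iN, β, σ, hd, hhK, hacc⟩ := hpack Δ Y hcPΔ hY 𝔭 h𝔭p h𝔭h h𝔭u hD hh' z hz hzle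
    refine ⟨K, iF, iN, β, σ, ?_, ?_, ?_⟩
    · exact hd.trans (pow_le_pow_left₀ (by positivity) (mul_le_mul_of_nonneg_right hcPc hΔ0.le) 3)
    · have hhK' : Height.logHeight (Fin.cons (1 : K) β : Fin (3 + 1) → K) ≤ cP * Y * Δ ^ 2 := by
        rw [show (3 : ℕ) - 1 = 2 from rfl] at hhK; exact hhK
      exact hhK'.trans (mul_le_mul_of_nonneg_right (mul_le_mul_of_nonneg_right hcPc hY0.le) (sq_nonneg _))
    · refine hacc.trans ?_
      rw [Real.exp_le_exp, neg_le_neg_iff]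
      exact div_le_div_of_nonneg_left (by positivity) hcP0 hcPc
  by_cases hF𝔮' : F ∈ 𝔮'
  · -- `F ∈ 𝔮'`: split `F = G₂ · ∏ᵢ pᵢ` and split its smallness
    obtain ⟨G₂, d₂, k, p, av, hG₂0, hG₂𝔮', hG₂hom, hp, hk, hFeq, hdeq, hG₂h, hph, hmax⟩ :=
      hsplit F d₁ 𝔮' hF0 hFhom h𝔮'p hF𝔮'
    have hMG₂ : 0 < maxNorm G₂ := maxNorm_pos hG₂0
    have hMp : ∀ i, 0 < maxNorm (p i) := fun i => maxNorm_pos (hp i).1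
    have hMP : 0 < ∏ i, maxNorm (p i) := Finset.prod_pos fun i _ => hMp i
    -- `|G₂(ω̄)| ∏ |pᵢ(ω̄)| = |F(ω̄)| ≤ e^{−R−4d₁} ≤ e^{−R} |G₂| ∏ |pᵢ|`
    have hkey : ‖aeval (Fin.cons 1 ω : Fin (3 + 1) → ℂ) G₂‖ *
        ∏ i, ‖aeval (Fin.cons 1 ω : Fin (3 + 1) → ℂ) (p i)‖ ≤
          Real.exp (-R) * (maxNorm G₂ * ∏ i, maxNorm (p i)) := by
      have hFval : ‖aeval (Fin.cons 1 ω : Fin (3 + 1) → ℂ) F‖ =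
          ‖aeval (Fin.cons 1 ω : Fin (3 + 1) → ℂ) G₂‖ * ∏ i, ‖aeval (Fin.cons 1 ω : Fin (3 + 1) → ℂ) (p i)‖ := by
        rw [hFeq, map_mul, map_prod, norm_mul, norm_prod]
      have h1 : Real.exp (-(4 * (d₁ : ℝ))) ≤ maxNorm G₂ * ∏ i, maxNorm (p i) :=
        exp_neg_le_of_one_le (hF1.trans hmax)
      have hexp : Real.exp (cB * ((d₁ : ℝ) + 1) -
          ((((d₁ + 3).choose d₁ : ℕ) : ℝ) - 4) / 2 * Real.log ((N : ℝ) + 1)) =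
            Real.exp (-R) * Real.exp (-(4 * (d₁ : ℝ))) := by
        rw [← Real.exp_add]
        congr 1
        rw [hRdef]
        ring
      rw [← hFval]
      exact hFsmall.trans (hexp.le.trans (mul_le_mul_of_nonneg_left h1 (Real.exp_pos _).le))
    by_cases hA : ‖aeval (Fin.cons 1 ω : Fin (3 + 1) → ℂ) G₂‖ ≤ Real.exp (-(R / 2)) * maxNorm G₂
    · -- CASE A: the part OFF the satellite carries half of the smallness — the datum
      left
      have hd₂1 : 1 ≤ d₂ := by
        by_contra hd₂
        have hd₂0 : d₂ = 0 := by omega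
        have hGC : G₂ = C (G₂.coeff 0) :=
          totalDegree_eq_zero_iff_eq_C.mp (by rw [hG₂hom.totalDegree hG₂0, hd₂0])
        have hval : ‖aeval (Fin.cons 1 ω : Fin (3 + 1) → ℂ) G₂‖ = maxNorm G₂ := by
          rw [hGC, aeval_C, maxNorm_C', eq_ratCast, Complex.norm_ratCast, ← Real.norm_eq_abs,
            Rat.norm_cast_real]
        rw [hval] at hA
        have h1 : (1 : ℝ) ≤ Real.exp (-(R / 2)) := le_of_mul_le_mul_right (by rw [one_mul]; exact hA) hMG₂
        linarith
      have hd₂le : d₂ ≤ d₁ := by omega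
      have hG₂h' : height G₂ ≤ 2 * Y / c₁ := by
        have e : (2 : ℝ) * Y / c₁ = 2 * (Y / c₁) := by ring
        linarith [hG₂h]
      exact caseA G₂ d₂ hG₂0 hG₂𝔮' hG₂hom hd₂1 hd₂le hG₂h' hA
    · -- CASE B: the `𝔮'`-part carries half of the smallness — a SMALL prime factor in `𝔮'`
      right
      have hprodle : ∏ i, ‖aeval (Fin.cons 1 ω : Fin (3 + 1) → ℂ) (p i)‖ ≤
          Real.exp (-(R / 2)) * ∏ i, maxNorm (p i) := prod_part_le hMG₂ hMP hkey (not_le.mp hA)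
      -- the rate per unit of degree, and the weighted pigeonhole over the prime factors
      obtain ⟨ε, hεdef⟩ : ∃ ε : ℝ, ε = (Δ / M₁) ^ 2 * (8 * Y) / (3200 * c₁) := ⟨_, rfl⟩
      have hε0 : 0 ≤ ε := by rw [hεdef]; positivity
      have hRB : κ ^ 3 * Δ ^ 3 * Y / (200 * c₁) ≤ R := by
        rw [hRdef]
        exact rateB_le hc₁ hcB hκ0 hκΔ10 hthr hc₁Δ hY hlogN1 hr₀def hrate hd₁le
      have hsumle : (∑ i, (av i : ℝ)) * ε ≤ R / 2 := by
        have hnat : ∑ i, av i ≤ d₁ := by omega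
        have hsum : (∑ i, (av i : ℝ)) ≤ d₁ := by
          have : ((∑ i, av i : ℕ) : ℝ) ≤ d₁ := by exact_mod_cast hnat
          push_cast at this
          exact this
        have h1 : (∑ i, (av i : ℝ)) * ε ≤ (κ * Δ) * ε := mul_le_mul_of_nonneg_right (hsum.trans hd₁le) hε0
        have h2 : 2 * ((κ * Δ) * ε) = κ ^ 3 * Δ ^ 3 * Y / (200 * c₁) := by
          rw [hεdef, hκdef]
          field_simp
          ring
        linarith
      obtain ⟨i₀, hi₀⟩ : ∃ i, ‖aeval (Fin.cons 1 ω : Fin (3 + 1) → ℂ) (p i)‖ ≤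
          Real.exp (-((av i : ℝ) * ε)) * maxNorm (p i) :=
        exists_le_exp_mul hk (x := fun i => ‖aeval (Fin.cons 1 ω : Fin (3 + 1) → ℂ) (p i)‖)
          (M := fun i => maxNorm (p i)) (a := fun i => (av i : ℝ)) hMp hprodle hsumle
      -- the witness `Q₂ = p i₀`
      obtain ⟨hp0, hp𝔮', hphom, ha1, hpprime⟩ := hp i₀
      have hsmallp : normAt (Fin.cons 1 ω) (p i₀) ≤
          Real.exp (-((av i₀ : ℝ) * (Δ / M₁) ^ 2 * (8 * Y) / (3200 * c₁))) := by
        have h1 : normAt (Fin.cons 1 ω) (p i₀) ≤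
            ‖aeval (Fin.cons 1 ω : Fin (3 + 1) → ℂ) (p i₀)‖ / maxNorm (p i₀) := by
          unfold normAt
          exact div_le_div_of_nonneg_left (norm_nonneg _) (hMp i₀)
            (le_mul_of_one_le_right (hMp i₀).le (one_le_pow₀ hω₁1))
        have h2 : ‖aeval (Fin.cons 1 ω : Fin (3 + 1) → ℂ) (p i₀)‖ / maxNorm (p i₀) ≤
            Real.exp (-((av i₀ : ℝ) * ε)) := (div_le_iff₀ (hMp i₀)).mpr hi₀
        have h3 : (av i₀ : ℝ) * (Δ / M₁) ^ 2 * (8 * Y) / (3200 * c₁) = (av i₀ : ℝ) * ε := by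
          rw [hεdef]
          ring
        rw [h3]
        exact h1.trans h2
      have ha_le : av i₀ ≤ d₁ := by
        have := Finset.single_le_sum (f := av) (fun j _ => Nat.zero_le _) (Finset.mem_univ i₀)
        omega
      have hdvd : p i₀ ∣ F := by
        rw [hFeq]
        exact (Finset.dvd_prod_of_mem p (Finset.mem_univ i₀)).mul_left G₂
      have hheight : height (p i₀) ≤ 8 * Y / c₁ + 4 * Δ / M₁ := by
        have e1 := hph i₀
        have e2 : Y / c₁ ≤ 8 * Y / c₁ := by rw [div_le_div_iff_of_pos_right hc₁0]; linarith
        have e3 : (4 : ℝ) * Δ / M₁ = 4 * (Δ / M₁) := by ring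
        linarith
      exact ⟨F, p i₀, d₁, av i₀, hF0, hFhom, hd₁pos, hd₁M, hFh8, hp0, hphom, ha1, ha_le, hpprime, hdvd, hp𝔮',
        hheight, hsmallp⟩
  · -- `F ∉ 𝔮'`: the Dirichlet form itself is off the satellite
    left
    refine caseA F d₁ hF0 hF𝔮' hFhom hd₁pos le_rfl ?_ ?_
    · have e : (2 : ℝ) * Y / c₁ = 2 * (Y / c₁) := by ring
      have e' : (0 : ℝ) ≤ Y / c₁ := by positivity
      linarith
    · have h1 : Real.exp (cB * ((d₁ : ℝ) + 1) -
          ((((d₁ + 3).choose d₁ : ℕ) : ℝ) - 4) / 2 * Real.log ((N : ℝ) + 1)) ≤ Real.exp (-(R / 2)) :=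
        Real.exp_le_exp.mpr (by linarith)
      exact hFsmall.trans (h1.trans (le_mul_of_one_le_right (Real.exp_pos _).le hF1))

end Summit.Schanuel.Schanuel.Cruxes.ApproximationProperty.OrbitInterpolationDeterminant

end
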